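import Summits.CriticalPhenomena.Ising3DConformalLimit.Theorems.StrandShadow.Negative.ClusterDecomposition
import Literature.Probability.LatticeModels.LoopO1
import Literature.Probability.LatticeModels.ModifiedSimonInequality
import HarnessLib

/-!
# Route `FKParityRobustness`, crux `StrandShadow` (stmt-CriticalPhenomena-14626):
# vocabulary of the line `odd-cluster-cut-exact-helper`

Route-posited objects (D-0016 Defs file) shared by the registered stubs of the checked skeleton
`Cruxes/StrandShadow/Lines/odd_cluster_cut_exact_helper.lean` (namespace
`…Cruxes.StrandShadow.OddClusterCutExactHelper`) and by the `--supports` files that prove them.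
Everything here is a plain finite-graph / finite-sum definition over the tree's `tJoins`,
`loopO1PartitionFunction` (`Literature/Probability/LatticeModels/LoopO1.lean`), `isingCorr`
(`IsingModel.lean`) and the cluster vocabulary `Rch`, `clusterEdges` of
`Theorems/StrandShadow/Negative/ClusterDecomposition.lean`; nothing is asserted.

For a finite graph `G`, four marked vertices `a : Fin 4 → V` and `t = tanh β`:
* `etaWeight G t η` — the product Bernoulli(`t²`) weight of a sprinkled edge set `η ⊆ E(G)`
  (the union of the two independent even-positive fields of Aizenman's double current `n^A + n^∅`
  read through the trace dictionary `trace(n) = odd(n) ∪ Bern(1 − sech β)`);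
* `jointJoinMass` (`JJ`), `allJoinedMass` (`AJ`), `pairingSet`, `pairIdx` (odd-cluster pairs
  `(K, K′) = (K_{a₀}(F), K_{a₂}(F))` of the pairing `A`-joins), `fibre`, `holedVol`
  (`H = V ∖ (V(K) ∪ V(K′))`), `attachPairs`, `firstMom` (the switched first moment
  `t⁴ Σ ⟨σ_uσ_v⟩^free_H ⟨σ_uσ_v⟩^free_G`), `medium`, `bridges` (helper-bridge count), `cfg`,
  `cfgWeight`, `fibreMass` (`W`), `bridgeMoment` (`M_n`), `bridgedMass` (`BB`), `goodPairs`.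

References: M. Aizenman, H. Duminil-Copin, V. Sidoravicius, Comm. Math. Phys. 334 (2015) Lemma 2.2;
M. Aizenman, Comm. Math. Phys. 86 (1982); the line card `Cruxes/StrandShadow/Lines/odd-cluster-cut-exact-helper.md`.
-/

noncomputable section

open Finset SimpleGraph
open Literature.Probability.LatticeModels
open Summit.CriticalPhenomena.Ising3DConformalLimit.StrandShadowNegative (Rch clusterEdges)

namespace Summit.CriticalPhenomena.Ising3DConformalLimit.Theorems.StrandShadowOddCut

open scoped Classical

section Defs

variable {V : Type*} [Fintype V] [DecidableEq V] (G : SimpleGraph V) [DecidableRel G.Adj]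

/-- Product Bernoulli(`t²`) weight of a sprinkled edge set `η ⊆ E(G)` (`1 − sech²β = tanh²β`:
the union of the two independent "even-positive" fields of the currents `n^A`, `n^∅`). -/
def etaWeight (t : ℝ) (η : Finset (Sym2 V)) : ℝ :=
  (t ^ 2) ^ η.card * (1 - t ^ 2) ^ (G.edgeFinset.card - η.card)

/-- `JJ`: the joined mass of `(F, F′, η)`, `F ∈ 𝒯_A`, `F′ ∈ 𝒯_∅`, `η ⊆ E(G)` (all four marked
vertices in one component of `F ∪ F′ ∪ η`) — in current language
`Z_A Z_∅ · P^{A}⊗P^{∅}[A joined in n₁ + n₂]` (up to the common `cosh` factors). -/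
def jointJoinMass (β : ℝ) (a : Fin 4 → V) : ℝ :=
  ∑ F ∈ tJoins G Set.univ (Finset.univ.image a), ∑ F' ∈ tJoins G Set.univ (∅ : Finset V),
    ∑ η ∈ G.edgeFinset.powerset,
      if (∀ i j : Fin 4, Rch (F ∪ F' ∪ η) (a i) (a j)) then
        Real.tanh β ^ F.card * Real.tanh β ^ F'.card * etaWeight G (Real.tanh β) η
      else 0

/-- `AJ`: the mass of the `A`-joins whose `a₀`-cluster already contains `a₁, a₂, a₃`. -/
def allJoinedMass (β : ℝ) (a : Fin 4 → V) : ℝ :=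
  ∑ F ∈ (tJoins G Set.univ (Finset.univ.image a)).filter (fun F : Finset (Sym2 V) =>
      Rch F (a 0) (a 1) ∧ Rch F (a 0) (a 2) ∧ Rch F (a 0) (a 3)), Real.tanh β ^ F.card

/-- The pairing event `01|23`: the `a₀`-cluster of `F ∈ 𝒯_A` reaches neither `a₂` nor `a₃`. -/
def pairingSet (a : Fin 4 → V) : Finset (Finset (Sym2 V)) :=
  (tJoins G Set.univ (Finset.univ.image a)).filter (fun F : Finset (Sym2 V) =>
      ¬ Rch F (a 0) (a 2) ∧ ¬ Rch F (a 0) (a 3))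

/-- The index set of odd-cluster pairs `(K, K′) = (K_{a₀}(F), K_{a₂}(F))`, `F` a pairing `A`-join. -/
def pairIdx (a : Fin 4 → V) : Finset (Finset (Sym2 V) × Finset (Sym2 V)) :=
  (pairingSet G a).image fun F => (clusterEdges F (a 0), clusterEdges F (a 2))

/-- The fibre of `(K, K′)`: the `A`-joins with exactly these two odd clusters. -/
def fibre (a : Fin 4 → V) (KK : Finset (Sym2 V) × Finset (Sym2 V)) : Finset (Finset (Sym2 V)) :=
  (tJoins G Set.univ (Finset.univ.image a)).filter (fun F : Finset (Sym2 V) =>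
      clusterEdges F (a 0) = KK.1 ∧ clusterEdges F (a 2) = KK.2)

/-- The holed volume `H = V ∖ (V(K) ∪ V(K′))`. -/
def holedVol (a : Fin 4 → V) (KK : Finset (Sym2 V) × Finset (Sym2 V)) : Finset V :=
  Finset.univ.filter fun v : V => ¬ Rch KK.1 (a 0) v ∧ ¬ Rch KK.2 (a 2) v

/-- Attaching pairs `((k,u),(k′,v))`: `k ∈ V(K)`, `k′ ∈ V(K′)`, `u ≠ v ∈ H`, `k ~ u`, `k′ ~ v`. -/
def attachPairs (a : Fin 4 → V) (KK : Finset (Sym2 V) × Finset (Sym2 V)) :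
    Finset ((V × V) × (V × V)) :=
  Finset.univ.filter fun p : (V × V) × (V × V) =>
    Rch KK.1 (a 0) p.1.1 ∧ p.1.2 ∈ holedVol a KK ∧ G.Adj p.1.1 p.1.2 ∧
    Rch KK.2 (a 2) p.2.1 ∧ p.2.2 ∈ holedVol a KK ∧ G.Adj p.2.1 p.2.2 ∧ p.1.2 ≠ p.2.2

/-- The SWITCHED first moment `t⁴ Σ_{(k,u),(k′,v)} ⟨σ_uσ_v⟩^free_H · ⟨σ_uσ_v⟩^free_G`. -/
def firstMom (β : ℝ) (a : Fin 4 → V) (KK : Finset (Sym2 V) × Finset (Sym2 V)) : ℝ :=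
  Real.tanh β ^ 4 * ∑ p ∈ attachPairs G a KK,
    isingCorr G (holedVol a KK) β 0 .free {p.1.2, p.2.2} *
      isingCorr G Finset.univ β 0 .free {p.1.2, p.2.2}

/-- The medium: the edges of `U` with both endpoints in the holed volume. -/
def medium (a : Fin 4 → V) (KK : Finset (Sym2 V) × Finset (Sym2 V)) (U : Finset (Sym2 V)) :
    Finset (Sym2 V) :=
  U.filter fun e => ∀ x ∈ e, x ∈ holedVol a KK

/-- The helper-bridge count `N(F, F′, η)`: attaching pairs whose two attaching bonds are sprinkled
and whose feet `u, v` are joined INSIDE `H` by `F ∪ F′ ∪ η`. -/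
def bridges (a : Fin 4 → V) (KK : Finset (Sym2 V) × Finset (Sym2 V)) (F F' η : Finset (Sym2 V)) : ℕ :=
  ((attachPairs G a KK).filter fun p : (V × V) × (V × V) =>
      s(p.1.1, p.1.2) ∈ η ∧ s(p.2.1, p.2.2) ∈ η ∧
        Rch (medium a KK (F ∪ F' ∪ η)) p.1.2 p.2.2).card

/-- Configurations `(F, F′, η)` over the fibre of `(K, K′)`. -/
def cfg (a : Fin 4 → V) (KK : Finset (Sym2 V) × Finset (Sym2 V)) :
    Finset (Finset (Sym2 V) × Finset (Sym2 V) × Finset (Sym2 V)) :=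
  fibre G a KK ×ˢ (tJoins G Set.univ (∅ : Finset V) ×ˢ G.edgeFinset.powerset)

/-- Weight `t^{|F|} t^{|F′|} w(η)` of a configuration. -/
def cfgWeight (β : ℝ) (x : Finset (Sym2 V) × Finset (Sym2 V) × Finset (Sym2 V)) : ℝ :=
  Real.tanh β ^ x.1.card * Real.tanh β ^ x.2.1.card * etaWeight G (Real.tanh β) x.2.2

/-- `W(K,K′)`: the mass of the fibre. -/
def fibreMass (β : ℝ) (a : Fin 4 → V) (KK : Finset (Sym2 V) × Finset (Sym2 V)) : ℝ :=
  ∑ x ∈ cfg G a KK, cfgWeight G β x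

/-- `M_n(K,K′)`: the `n`-th moment mass of the bridge count over the fibre. -/
def bridgeMoment (n : ℕ) (β : ℝ) (a : Fin 4 → V) (KK : Finset (Sym2 V) × Finset (Sym2 V)) : ℝ :=
  ∑ x ∈ cfg G a KK, cfgWeight G β x * ((bridges G a KK x.1 x.2.1 x.2.2 : ℝ)) ^ n

/-- `BB(K,K′)`: the bridged mass of the fibre (at least one helper bridge). -/
def bridgedMass (β : ℝ) (a : Fin 4 → V) (KK : Finset (Sym2 V) × Finset (Sym2 V)) : ℝ :=
  ∑ x ∈ cfg G a KK, if 1 ≤ bridges G a KK x.1 x.2.1 x.2.2 then cfgWeight G β x else 0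

/-- Good pairs: switched first moment `≥ c₁` and matched second moment `M₂ ≤ C₂·W·firstMom²`
(i.e. `E[N² | K,K′] ≤ C₂ E[N | K,K′]²` once `stub_oddClusterCutFirstMoment` is in). -/
def goodPairs (β : ℝ) (a : Fin 4 → V) (c₁ C₂ : ℝ) : Finset (Finset (Sym2 V) × Finset (Sym2 V)) :=
  (pairIdx G a).filter fun KK =>
    c₁ ≤ firstMom G β a KK ∧ bridgeMoment G 2 β a KK ≤ C₂ * fibreMass G β a KK * firstMom G β a KK ^ 2

end Defs

/-! ## Basic sign facts (the bookkeeping lemma `oddCut_fibreMass_nonneg` is the registered hook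
through which this vocabulary file lands as a `--supports` file; `0 ≤ tanh β` and `tanh² β < 1` are
inlined from Mathlib — `Real.tanh_eq_sinh_div_cosh`, `Real.tanh_sq_lt_one` — per review of p96036) -/

section Basic

variable {V : Type*} [Fintype V] [DecidableEq V] (G : SimpleGraph V) [DecidableRel G.Adj]

omit [DecidableEq V] in
/-- The sprinkle weight is nonnegative. -/
theorem etaWeight_nonneg (β : ℝ) (η : Finset (Sym2 V)) : 0 ≤ etaWeight G (Real.tanh β) η := by
  unfold etaWeight
  exact mul_nonneg (pow_nonneg (sq_nonneg _) _)
    (pow_nonneg (sub_nonneg.2 (Real.tanh_sq_lt_one β).le) _)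

omit [DecidableEq V] in
/-- Configuration weights are nonnegative for `β ≥ 0`. -/
theorem cfgWeight_nonneg {β : ℝ} (hβ : 0 ≤ β)
    (x : Finset (Sym2 V) × Finset (Sym2 V) × Finset (Sym2 V)) : 0 ≤ cfgWeight G β x := by
  unfold cfgWeight
  have ht : 0 ≤ Real.tanh β := by
    rw [Real.tanh_eq_sinh_div_cosh]
    exact div_nonneg (Real.sinh_nonneg_iff.2 hβ) (Real.cosh_pos _).le
  exact mul_nonneg (mul_nonneg (pow_nonneg ht _) (pow_nonneg ht _)) (etaWeight_nonneg G β _)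

/-- **oddCut_fibreMass_nonneg**: the fibre mass `W(K,K′)` is nonnegative for `β ≥ 0`. -/
theorem oddCut_fibreMass_nonneg :
    ∀ (V : Type) [Fintype V] [DecidableEq V] (G : SimpleGraph V) [DecidableRel G.Adj] (β : ℝ),
      0 ≤ β → ∀ (a : Fin 4 → V) (KK : Finset (Sym2 V) × Finset (Sym2 V)), 0 ≤ fibreMass G β a KK := by
  intro V _ _ G _ β hβ a KK
  exact Finset.sum_nonneg fun x _ => cfgWeight_nonneg G hβ x

/-- The bridged mass `BB(K,K′)` is nonnegative for `β ≥ 0`. -/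
theorem bridgedMass_nonneg {β : ℝ} (hβ : 0 ≤ β) (a : Fin 4 → V)
    (KK : Finset (Sym2 V) × Finset (Sym2 V)) : 0 ≤ bridgedMass G β a KK := by
  refine Finset.sum_nonneg fun x _ => ?_
  split_ifs
  · exact cfgWeight_nonneg G hβ x
  · exact le_rfl

/-- The bridge moments `M_n(K,K′)` are nonnegative for `β ≥ 0`. -/
theorem bridgeMoment_nonneg {β : ℝ} (hβ : 0 ≤ β) (n : ℕ) (a : Fin 4 → V)
    (KK : Finset (Sym2 V) × Finset (Sym2 V)) : 0 ≤ bridgeMoment G n β a KK :=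
  Finset.sum_nonneg fun x _ => mul_nonneg (cfgWeight_nonneg G hβ x) (pow_nonneg (Nat.cast_nonneg _) _)

end Basic

end Summit.CriticalPhenomena.Ising3DConformalLimit.Theorems.StrandShadowOddCut

end
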